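import Summits.ABC.Harvest.OpenQuestions
import Summits.ABC.Analytic.PolySzpiro
import Literature.NumberTheory.EllipticCurves.PastenHeightBoundsClassicalInputProofs
import Literature.NumberTheory.EllipticCurves.PastenSpectralDegreeProofs
import Literature.NumberTheory.EllipticCurves.CuspFormLFunctionLevelConductorProofs
import Literature.NumberTheory.EllipticCurves.ModularParametrizationBCDTProofs
import Literature.NumberTheory.DiophantineGeometry.FaltingsHeightProofs
import Literature.NumberTheory.DiophantineGeometry.MinimalDiscriminantRingOfIntegersProofs
import HarnessLib

/-!
# ABC harvest 2015–2026: Murty's congruence-number conjecture and the modular degree conjecture reach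
# polynomial Szpiro, with explicit constants (glue, modular doors)

`Summits/ABC/Harvest/GlueModular.lean` — cell `abc-harv` (C3), seat `abc-harv-pr-1` (KEY GLUE-MODULAR), namespace
`Summit.ABC.Harvest`. PROOF-ONLY file (no definition, no `sorry`, no axiom, no Literature fact): the arrows of the
cell's §GLUE LEDGER from the TYPED modular doors of `OpenQuestions.lean` §2 — `MurtyCongruenceNumberConjecture`
(Murty 1999 / Murty–Pasten 2013 p. 3748, `log n_f ≪ log N`; row H-022, census C4 = desk O-68) and
`ModularDegreeConjecture` (Frey / Pasten 2024 Conj. 3.2, `log δ_{1,N} ≪ log N_E`; row H-020, C3 = O-66) — to the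
sub-summit rung **A-PS** `Summit.ABC.PolySzpiroRat` / `Summit.ABC.PolySzpiroRatEff K C`
(`Summits/ABC/Analytic/PolySzpiro.lean`), in EFFECTIVE form (every constant explicit) and in the `∃ K C` form of
the doors. Chain (Murty–Pasten 2013 Thm. 4.5; Pasten 2024 §3 (3.4)):

  `log n_f ≤ K log N + C` ⟹[Ribet `m_f ∣ n_f`, `n_f > 0`] `log δ_{1,N} ≤ K log N + C`
  ⟹[(EqHDeg) `h(E) ≤ ½ log δ_{1,N} + 9`: modularity, Zagier, Mazur–Kenku] `h_F(E) ≤ (K/2) log N_E + (C+1)/2 + 12`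
  ⟹[`log|Δ_min| < 12 h_F + 16`] `log|Δ_min(E)| ≤ 6K · log N_E + 6C + 166` for ALL elliptic `E/ℚ`.

* `congruenceNumber_ne_zero_of_parametrization` — **positivity of the congruence number `n_f = r_f` of the newform
  of an elliptic curve, PROVED** (never assumed): from the tree-PROVED `r_f ∣ ∏_{P ≠ 𝕀_f} η_f(P)` (Pasten 2024
  §5.6, `ModularParametrizationData.congruenceNumber_dvd_prod_heckeCongruenceModulus`) and `0 < ∏ η_f(P)`
  (`ModularParametrizationData.prod_heckeCongruenceModulus_pos`). It discharges the junk guard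
  `congruenceNumber D.f ≠ 0` of `MurtyCongruenceNumberConjecture` (REF-B P-7(c)).
* `log_modularDegree_le_of_log_congruenceNumber_le`, `modularDegreeConjecture_of_murtyCongruenceNumberConjecture` —
  **Murty ⟹ modular degree conjecture**, constants unchanged, MODULO ONE named fact: Ribet's theorem `m_f ∣ n_f`
  (`ModularForms.modularDegree_dvd_congruenceNumber`, Agashe–Ribet–Stein 2012 Thm. 2.1(a); recorded, not proved,
  in the tree).
* `faltingsHeight_le_of_log_modularDegree_le` — **modular degree bound ⟹ Faltings-height bound, EFFECTIVE**
  (`(K, C) ↦ (K/2, (C+1)/2 + 12)`), MODULO TWO named facts: modularity with an integral Manin constant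
  (`ModularForms.nonempty_modularParametrizationData`; Wiles, Taylor–Wiles, BCDT + Edixhoven) and Mazur–Kenku
  (`ModularForms.PastenShimura2024_minimalDegree_le_163_mul`, minimal degree in the class `≤ 163 · δ_{1,N}`), over
  the tree-PROVED (EqHDeg) `pasten2024_eq_3_4_of_modularity'` and `Pasten2024.log_minModularDegree_le_of_class_bound`;
  the conductor guard of the door is met at the class-minimal datum by strong multiplicity one
  (`IsNewformOf.level_eq_conductorNorm_of_exists_conductorLevel`). The `∃`-form `ModularDegreeConjecture ⟹
  HeightConjecture` is the cell's `heightConjecture_of_modularDegreeConjecture` (`OpenQuestionsGlueDegree.lean`,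
  seat typ-1, p549047) — not restated here.
* `polySzpiroRatEff_of_log_modularDegree_le`, `polySzpiroRatEff_of_log_congruenceNumber_le` — **the doors in
  EFFECTIVE form land on `Summit.ABC.PolySzpiroRatEff (6K) (6C + 166)`** (the Faltings-height / minimal-discriminant
  comparison `log|Δ_min| < 12 h_F + 16` is tree-PROVED: `WeierstrassCurve.log_minimalDiscriminantNorm_lt_faltingsHeight_holds`,
  Pasten 2024 Lemma 18.1 — it is NOT a hypothesis).
* `heightConjecture_of_murtyCongruenceNumberConjecture`, **`polySzpiroRat_of_murtyCongruenceNumberConjecture`**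
  (§GLUE LEDGER **G-08**) and **`polySzpiroRat_of_modularDegreeConjecture`** (G-07 ∘ G-06; the `∃`-form through
  `HeightConjecture` is typ-1's `heightConjecture_of_modularDegreeConjecture` + `polySzpiroRat_of_heightConjecture`,
  p548749) — the doors' own `∃ K C` sentences reach `Summit.ABC.PolySzpiroRat` for ALL `E/ℚ`.

Hypotheses displayed, none silent: `hR` (Ribet), `hmod` (modularity), `h163` (Mazur–Kenku) — printed theorems,
tree-RECORDED named facts, UNPROVED in the tree. What is NOT here: Murty–Pasten's stronger Conj. 4.4 (`n′_f`; typed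
by the abc-an cell as `Summit.ABC.Analytic.MurtyPastenConj44`); the Shimura-curve degrees `δ_{D,M}` (row H-020,
glue G-09); any converse (none in print: Murty–Pasten p. 3748 "We do not know if a sufficiently strong version of
the ABC conjecture implies Conjecture 4.4"); the sharp Frey-curve door at rung A0 (H-001,
`Summit.ABC.ABC.Theorems.degreeBoundToABCOfPetersson_proof`).

HONESTY LINE (D-0139/D-0140): abc is not proved by any of this; A-PS is NOT abc — «NOT abc — POLY-SZPIRO(6K)»;
PROVED-MOD-FACTS ≠ proved; typed ≠ proved; the conjectures are hypotheses, never asserted.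
-/

noncomputable section

namespace Summit.ABC.Harvest

open WeierstrassCurve
open Literature.NumberTheory.EllipticCurves
open Literature.NumberTheory.EllipticCurves.ModularForms
open Literature.NumberTheory.EllipticCurves.Pasten2024
open ModularForm CongruenceSubgroup
open scoped MatrixGroups

/-! ## Positivity of the congruence number (PROVED) -/

/-- **The congruence number of the newform of an elliptic curve is a positive integer** (Agashe–Ribet–Stein 2012
§2.1 "the positive integer `r_E`"), PROVED over the tree: `r_f ∣ ∏_{P ≠ 𝕀_f} η_f(P)` (Pasten 2024 §5.6, second
proof of Thm. 5.5; `ModularParametrizationData.congruenceNumber_dvd_prod_heckeCongruenceModulus`) and the product of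
the congruence moduli is positive (`ModularParametrizationData.prod_heckeCongruenceModulus_pos`), so the `Nat.card`
defining `congruenceNumber D.f` is not at its junk value `0`. Any level `N ≥ 1`, any datum.
[cite: PastenShimura2024, §5.6 p. 19] [cite: AgasheRibetStein2012, §2.1] -/
theorem congruenceNumber_ne_zero_of_parametrization {W : WeierstrassCurve ℚ} {N : ℕ} [NeZero N]
    (D : ModularParametrizationData W N) : congruenceNumber D.f ≠ 0 :=
  (Nat.pos_of_dvd_of_pos D.congruenceNumber_dvd_prod_heckeCongruenceModulus
    D.prod_heckeCongruenceModulus_pos).ne'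

/-! ## Murty's `log n_f ≪ log N` ⟹ the modular degree conjecture (modulo Ribet `m_f ∣ n_f`) -/

/-- **Murty's bound transfers to the optimal modular degree with the SAME constants** (Murty–Pasten 2013 p. 3748;
the step `m_f ≤ n_f`): if `log n_{D.f} ≤ K log N + C` for every datum `D` at conductor level with `n_{D.f} ≠ 0`, then
`log δ_{1,N} ≤ K log N + C` for every datum of minimal degree in its class at conductor level. Hypothesis `hR` =
Ribet's theorem `m_f ∣ n_f` (`modularDegree_dvd_congruenceNumber`, Agashe–Ribet–Stein 2012 Thm. 2.1(a): a printed
theorem recorded, not proved, in the tree); `n_f > 0` is `congruenceNumber_ne_zero_of_parametrization` (PROVED).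
[cite: MurtyPasten2013, p. 3748 (paragraph after Conj. 4.4)] [cite: AgasheRibetStein2012, Thm. 2.1] -/
theorem log_modularDegree_le_of_log_congruenceNumber_le
    (hR : modularDegree_dvd_congruenceNumber) {K C : ℝ}
    (h : ∀ (W : WeierstrassCurve ℚ) [W.IsElliptic] (N : ℕ) [NeZero N]
      (D : ModularParametrizationData W N), W.conductorNorm ℤ = N → congruenceNumber D.f ≠ 0 →
        Real.log (congruenceNumber D.f : ℝ) ≤ K * Real.log (N : ℝ) + C)
    (W : WeierstrassCurve ℚ) [W.IsElliptic] (N : ℕ) [NeZero N]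
    (D : ModularParametrizationData W N) (hN : W.conductorNorm ℤ = N)
    (hmin : ∀ (W' : WeierstrassCurve ℚ) [W'.IsElliptic] (D' : ModularParametrizationData W' N),
      D'.f = D.f → D.modularDegree ≤ D'.modularDegree) :
    Real.log (D.modularDegree : ℝ) ≤ K * Real.log (N : ℝ) + C := by
  have hr : congruenceNumber D.f ≠ 0 := congruenceNumber_ne_zero_of_parametrization D
  have hle : D.modularDegree ≤ congruenceNumber D.f :=
    Nat.le_of_dvd (Nat.pos_of_ne_zero hr) (hR W N D hmin)
  have hdeg : (0 : ℝ) < (D.modularDegree : ℝ) := by exact_mod_cast D.deg_pos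
  calc Real.log (D.modularDegree : ℝ)
      ≤ Real.log (congruenceNumber D.f : ℝ) := Real.log_le_log hdeg (by exact_mod_cast hle)
    _ ≤ K * Real.log (N : ℝ) + C := h W N D hN hr

/-- **GLUE (PROVED MODULO ONE NAMED FACT): `MurtyCongruenceNumberConjecture ⟹ ModularDegreeConjecture`**
(Murty–Pasten 2013 p. 3748: "`log m_f ≪ log N` is due to Frey … Murty formulated the conjecture `log n_f ≪ log N`";
`n_f`-form ⟹ `m_f`-form by Ribet `m_f ∣ n_f`, hypothesis `hR` = `modularDegree_dvd_congruenceNumber`,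
ARS 2012 Thm. 2.1(a)). Constants `(K, C)` unchanged; positivity of `n_f` PROVED, not assumed.
[cite: MurtyPasten2013, p. 3748] [cite: AgasheRibetStein2012, Thm. 2.1] -/
theorem modularDegreeConjecture_of_murtyCongruenceNumberConjecture
    (hR : modularDegree_dvd_congruenceNumber)
    (h : MurtyCongruenceNumberConjecture) : ModularDegreeConjecture := by
  obtain ⟨K, C, hKC⟩ := h
  exact ⟨K, C, fun W _ N _ D hN hmin =>
    log_modularDegree_le_of_log_congruenceNumber_le hR hKC W N D hN hmin⟩

/-! ## The modular degree conjecture ⟹ the Height conjecture ⟹ A-PS, with explicit constants -/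

/-- **EFFECTIVE GLUE (PROVED MODULO TWO NAMED FACTS): a bound `log δ_{1,N} ≤ K log N + C` on the optimal modular
degree gives `h_F(E) ≤ (K/2) · log N_E + ((C+1)/2 + 12)` for EVERY elliptic curve `E/ℚ`** (Pasten 2024 §3 (3.4)
"`h(E) ≤ h(A_{1,N}) + 3 ≤ ½ log δ_{1,N} + 9`"; Murty–Pasten 2013 Thm. 4.5 / Prop. 6.3). Hypotheses: `hmod` =
modularity with an integral Manin constant (`nonempty_modularParametrizationData`), `h163` = Mazur–Kenku
(`PastenShimura2024_minimalDegree_le_163_mul`). Proof over tree-PROVED inputs: a global minimal model `C₁ • W`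
(`hasGlobalMinimalModel_rat_holds`; `h_F`, `N_E` are model-independent), a datum `D` of it (`hmod`),
`h_F = h(D.L)` (`ModularParametrizationData.faltingsHeight_eq`), (EqHDeg) in the form
`h(D.L) ≤ ½ log(minimal degree of the model) + 9` (`pasten2024_eq_3_4_of_modularity'`: Zagier's identity, `c² ≥ 1`,
trivial Petersson bound), the class bound `log(minimal degree) ≤ log 163 + B` (`log_minModularDegree_le_of_class_bound`,
Mazur–Kenku) with `B = K log N + C + 1` supplied by the hypothesis at the class-minimal datum `D₀` of its curve `W₀` —
whose level `N_E` IS the conductor of `W₀` by strong multiplicity one applied to a modular minimal model of `W₀`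
(`IsNewformOf.level_eq_conductorNorm_of_exists_conductorLevel`, Atkin–Lehner / Carayol) — and `log 163 ≤ 6`. The
`∃`-form is the cell's `heightConjecture_of_modularDegreeConjecture` (typ-1). «NOT abc — POLY-SZPIRO(6K)» downstream.
[cite: PastenShimura2024, §3 (3.4) p. 13] [cite: MurtyPasten2013, Thm. 4.5 and Prop. 6.3] [cite: AtkinLehner1970, Thm. 4] -/
theorem faltingsHeight_le_of_log_modularDegree_le
    (hmod : nonempty_modularParametrizationData)
    (h163 : PastenShimura2024_minimalDegree_le_163_mul) {K C : ℝ}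
    (h : ∀ (W : WeierstrassCurve ℚ) [W.IsElliptic] (N : ℕ) [NeZero N]
      (D : ModularParametrizationData W N), W.conductorNorm ℤ = N →
      (∀ (W' : WeierstrassCurve ℚ) [W'.IsElliptic] (D' : ModularParametrizationData W' N),
          D'.f = D.f → D.modularDegree ≤ D'.modularDegree) →
        Real.log (D.modularDegree : ℝ) ≤ K * Real.log (N : ℝ) + C)
    (W : WeierstrassCurve ℚ) [W.IsElliptic] :
    W.faltingsHeight ≤ K / 2 * Real.log (W.conductorNorm ℤ : ℝ) + ((C + 1) / 2 + 12) := by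
  -- pass to a global minimal model `C₁ • W`
  obtain ⟨C₁, hC₁⟩ := hasGlobalMinimalModel_rat_holds W
  haveI := hC₁
  have hN : (C₁ • W).conductorNorm ℤ = W.conductorNorm ℤ := conductorNorm_smul_rat W C₁
  haveI : NeZero ((C₁ • W).conductorNorm ℤ) := ⟨(conductorNorm_pos_holds (C₁ • W)).ne'⟩
  rw [← faltingsHeight_smul W C₁, ← hN]
  set N : ℕ := (C₁ • W).conductorNorm ℤ with hNdef
  -- the class bound, fed by the hypothesis at the class-minimal datum `D₀` (level = conductor of its curve
  -- `W₀`: modularity of a minimal model of `W₀` + strong multiplicity one across levels)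
  have hclass := log_minModularDegree_le_of_class_bound h163 (hmod (C₁ • W))
    (B := K * Real.log N + C + 1)
    (fun W₀ _ D₀ hmin => by
      haveI : NeZero (W₀.conductorNorm ℤ) := ⟨(conductorNorm_pos_holds W₀).ne'⟩
      obtain ⟨C₀, hC₀⟩ := hasGlobalMinimalModel_rat_holds W₀
      haveI := hC₀
      haveI : NeZero ((C₀ • W₀).conductorNorm ℤ) := ⟨(conductorNorm_pos_holds (C₀ • W₀)).ne'⟩
      obtain ⟨D'⟩ := hmod (C₀ • W₀)
      have hW₀ : ∃ g : CuspForm (Gamma0 (W₀.conductorNorm ℤ)) 2, IsNewformOf W₀ g :=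
        exists_isNewformOf_of_level_eq (conductorNorm_smul_rat W₀ C₀)
          ⟨D'.f, IsNewformOf.of_smul C₀ D'.isNewformOf⟩
      have hlev : N = W₀.conductorNorm ℤ :=
        IsNewformOf.level_eq_conductorNorm_of_exists_conductorLevel hW₀ D₀.isNewformOf
      have := h W₀ N D₀ hlev.symm hmin
      linarith)
  -- (EqHDeg) for a datum of the minimal model, and `h_F = h(D.L)`
  obtain ⟨D⟩ := hmod (C₁ • W)
  have h34 := pasten2024_eq_3_4_of_modularity' hmod (C₁ • W) D.L D.isNeronLattice
  have hheight : (C₁ • W).faltingsHeight = neronLatticeHeight D.L := by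
    rw [D.faltingsHeight_eq, neronLatticeHeight]
  have h163' : Real.log 163 ≤ 6 := by
    have h8 : Real.log 163 ≤ 8 * Real.log 2 := by
      rw [← Real.log_rpow two_pos, Real.log_le_log_iff (by norm_num) (by positivity)]
      norm_num
    linarith [Real.log_two_lt_d9]
  rw [hheight]
  linarith

/-- **EFFECTIVE GLUE (PROVED MODULO TWO NAMED FACTS): `log δ_{1,N} ≤ K log N + C` on the optimal modular degree
⟹ `Summit.ABC.PolySzpiroRatEff (6K) (6C + 166)`**, i.e. `log|Δ_min(E)| ≤ 6K · log N_E + 6C + 166` for ALL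
elliptic `E/ℚ` — Pasten 2024 §1.4 / §3 "such a bound would imply Szpiro's conjecture!", in kernel form at rung A-PS
with every constant explicit. From `faltingsHeight_le_of_log_modularDegree_le` (`hmod`, `h163`) and the tree-PROVED
`log|Δ_min| < 12 h_F + 16` (`WeierstrassCurve.log_minimalDiscriminantNorm_lt_faltingsHeight_holds`, Pasten 2024
Lemma 18.1; over `ℚ`, `minimalDiscriminantNorm_ringOfIntegers_rat_holds`). EFFECTIVE: yes. «NOT abc — POLY-SZPIRO(6K)».
[cite: PastenShimura2024, §3 (3.4), Conj. 3.2 (p. 13) and Lemma 18.1] -/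
theorem polySzpiroRatEff_of_log_modularDegree_le
    (hmod : nonempty_modularParametrizationData)
    (h163 : PastenShimura2024_minimalDegree_le_163_mul) {K C : ℝ}
    (h : ∀ (W : WeierstrassCurve ℚ) [W.IsElliptic] (N : ℕ) [NeZero N]
      (D : ModularParametrizationData W N), W.conductorNorm ℤ = N →
      (∀ (W' : WeierstrassCurve ℚ) [W'.IsElliptic] (D' : ModularParametrizationData W' N),
          D'.f = D.f → D.modularDegree ≤ D'.modularDegree) →
        Real.log (D.modularDegree : ℝ) ≤ K * Real.log (N : ℝ) + C) :
    Summit.ABC.PolySzpiroRatEff (6 * K) (6 * C + 166) := by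
  intro W _
  have h1 := faltingsHeight_le_of_log_modularDegree_le hmod h163 h W
  have h2 := WeierstrassCurve.log_minimalDiscriminantNorm_lt_faltingsHeight_holds W
  rw [WeierstrassCurve.minimalDiscriminantNorm_ringOfIntegers_rat_holds W, Module.finrank_self,
    Nat.cast_one, inv_one, one_mul] at h2
  linarith

/-- **EFFECTIVE GLUE (PROVED MODULO THREE NAMED FACTS): Murty's `log n_f ≤ K log N + C` ⟹
`Summit.ABC.PolySzpiroRatEff (6K) (6C + 166)`** — the congruence-number door (Murty–Pasten 2013 p. 3748, Thm. 4.5)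
in kernel form with explicit constants: `hR` = Ribet `m_f ∣ n_f` (ARS 2012 Thm. 2.1(a)), `hmod` = modularity,
`h163` = Mazur–Kenku; positivity of `n_f` and `log|Δ_min| < 12 h_F + 16` are tree-PROVED. EFFECTIVE: yes.
«NOT abc — POLY-SZPIRO(6K)». [cite: MurtyPasten2013, p. 3748 and Thm. 4.5] [cite: AgasheRibetStein2012, Thm. 2.1]
[cite: PastenShimura2024, §3 (3.4) and Lemma 18.1] -/
theorem polySzpiroRatEff_of_log_congruenceNumber_le
    (hR : modularDegree_dvd_congruenceNumber)
    (hmod : nonempty_modularParametrizationData)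
    (h163 : PastenShimura2024_minimalDegree_le_163_mul) {K C : ℝ}
    (h : ∀ (W : WeierstrassCurve ℚ) [W.IsElliptic] (N : ℕ) [NeZero N]
      (D : ModularParametrizationData W N), W.conductorNorm ℤ = N → congruenceNumber D.f ≠ 0 →
        Real.log (congruenceNumber D.f : ℝ) ≤ K * Real.log (N : ℝ) + C) :
    Summit.ABC.PolySzpiroRatEff (6 * K) (6 * C + 166) :=
  polySzpiroRatEff_of_log_modularDegree_le hmod h163
    (fun W _ N _ D hN hmin => log_modularDegree_le_of_log_congruenceNumber_le hR h W N D hN hmin)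

/-! ## The doors' own `∃ K C` sentences reach `HeightConjecture` and `Summit.ABC.PolySzpiroRat` -/

/-- **GLUE (PROVED MODULO THREE NAMED FACTS): `MurtyCongruenceNumberConjecture ⟹ HeightConjecture`** (Murty–Pasten
2013 Thm. 4.5 chain `n_f ⟹ m_f ⟹ h_F`; Pasten 2024 (3.4)), with `(K, C) ↦ (K/2, (C+1)/2 + 12)`. Hypotheses `hR`
(Ribet), `hmod` (modularity), `h163` (Mazur–Kenku). [cite: MurtyPasten2013, Thm. 4.5 (p. 3748)]
[cite: PastenShimura2024, §3 (3.4) p. 13] -/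
theorem heightConjecture_of_murtyCongruenceNumberConjecture
    (hR : modularDegree_dvd_congruenceNumber)
    (hmod : nonempty_modularParametrizationData)
    (h163 : PastenShimura2024_minimalDegree_le_163_mul)
    (h : MurtyCongruenceNumberConjecture) : HeightConjecture := by
  obtain ⟨K, C, hKC⟩ := h
  exact ⟨K / 2, (C + 1) / 2 + 12, fun W _ => faltingsHeight_le_of_log_modularDegree_le hmod h163
    (fun W _ N _ D hN hmin => log_modularDegree_le_of_log_congruenceNumber_le hR hKC W N D hN hmin) W⟩

/-- **§GLUE LEDGER G-08 (PROVED MODULO THREE NAMED FACTS): Murty's congruence-number conjecture ⟹ polynomial Szpiro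
over `ℚ`, BY NAME on the rung decl `Summit.ABC.PolySzpiroRat`** — Murty–Pasten 2013 p. 3748 "both of these
conjectures imply a version of the ABC conjecture", in kernel form at rung A-PS: `log n_f ≤ K log N + C` for the
newforms of elliptic curves ⟹ `log|Δ_min(E)| ≤ 6K · log N_E + 6C + 166` for ALL `E/ℚ`
(`polySzpiroRatEff_of_log_congruenceNumber_le`). Hypotheses (displayed, none silent): `hR` = Ribet `m_f ∣ n_f`
(ARS 2012 Thm. 2.1(a)), `hmod` = modularity with an integral Manin constant (Wiles–BCDT + Edixhoven), `h163` =
Mazur–Kenku; the positivity `n_f > 0` and the comparison `log|Δ_min| < 12 h_F + 16` are tree-PROVED.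
«NOT abc — POLY-SZPIRO(6K)»; PROVED-MOD-FACTS ≠ proved; no converse is known in print.
[cite: MurtyPasten2013, p. 3748 and Thm. 4.5] [cite: PastenShimura2024, Conj. 3.2, (3.4), Lemma 18.1]
[cite: AgasheRibetStein2012, Thm. 2.1] -/
theorem polySzpiroRat_of_murtyCongruenceNumberConjecture
    (hR : modularDegree_dvd_congruenceNumber)
    (hmod : nonempty_modularParametrizationData)
    (h163 : PastenShimura2024_minimalDegree_le_163_mul)
    (h : MurtyCongruenceNumberConjecture) : Summit.ABC.PolySzpiroRat := by
  obtain ⟨K, C, hKC⟩ := h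
  exact ⟨6 * K, 6 * C + 166, polySzpiroRatEff_of_log_congruenceNumber_le hR hmod h163 hKC⟩

/-- **§GLUE LEDGER G-07 ∘ G-06 (PROVED MODULO TWO NAMED FACTS): the modular degree conjecture (Pasten Conj. 3.2)
⟹ polynomial Szpiro over `ℚ` for ALL `E/ℚ`, BY NAME on `Summit.ABC.PolySzpiroRat`** — modulo `hmod` (modularity)
and `h163` (Mazur–Kenku); the Faltings-height / minimal-discriminant comparison is tree-PROVED, so no further fact
enters (`polySzpiroRatEff_of_log_modularDegree_le`, exponent `6K`, constant `6C + 166`). Pasten 2024 §3: "the height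
conjecture (and hence, Szpiro's conjecture) would follow from" Conj. 3.2; the `∃`-route through `HeightConjecture` is
the cell's `heightConjecture_of_modularDegreeConjecture` + `polySzpiroRat_of_heightConjecture` (typ-1).
«NOT abc — POLY-SZPIRO(6K)». [cite: PastenShimura2024, §3 (3.4) and Conj. 3.2 (p. 13)] -/
theorem polySzpiroRat_of_modularDegreeConjecture
    (hmod : nonempty_modularParametrizationData)
    (h163 : PastenShimura2024_minimalDegree_le_163_mul)
    (h : ModularDegreeConjecture) : Summit.ABC.PolySzpiroRat := by
  obtain ⟨K, C, hKC⟩ := h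
  exact ⟨6 * K, 6 * C + 166, polySzpiroRatEff_of_log_modularDegree_le hmod h163 hKC⟩

end Summit.ABC.Harvest
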